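import Summits.BirchSwinnertonDyer.BirchSwinnertonDyer.Theses.ErratumRoadFive
import Summits.BirchSwinnertonDyer.Rank1Residual.X11b.MultiplicativeSurjectivity
import Literature.NumberTheory.EllipticCurves.Rank1Residual.X9NoEntry
import HarnessLib

/-!
# Route `ErratumRoadFive` (rung K2), crux `NonSurjCorner` (item stmt-BirchSwinnertonDyer-19065):
# THE TWO EXTRA BINDERS OF THE CRUX ARE IDLE — `p ∣ ord_p Δ_min` and `¬ Ram` follow from
# `ClassX11b ∧ ¬ Surj` in the kernel (cell `bsd-stepL`, seat `bsd-stepL-corner5-p2` g3, WIDTH-LEVER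
# lane B «class-level road»; `--supports stmt-BirchSwinnertonDyer-19065 --as helper`)

WHY THIS FILE. The crux `NonSurjCorner` and its two registered stubs `stub_corner5` / `stub_corner7`
(skeleton b2731b9ab55f) carry FIVE binders: `ClassX11b W p`, `¬ Surj W p`, `p = 5 ∨ p = 7` (resp.
`p = 5`, `p = 7`), `p ∣ padicValInt p W.minimalDiscriminantInt`, `¬ Ram W p`. The last two are
CONSEQUENCES of the first two, by theorems already in the tree:

* `p ∣ ord_p Δ_min`: x11c gen 8's `GaloisImage.surj_of_mult_of_irr_of_not_dvd`
  (`X11b/MultiplicativeSurjectivity.lean`: `Mult ∧ Irr ∧ p ∤ ord_p Δ_min ⟹ Surj` at every odd `p` —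
  the transvection of the «très ramifié» inertia at `p`, Silverman *ATAEC* V.6.1 at `ℓ = p`, plus
  Serre 1972 Prop. 15), read contrapositively;
* `¬ Ram`: `Rank1Residual.not_ram_of_irr_of_not_surj` (`X9NoEntry.lean`: an irreducible
  non-surjective image has order prime to `p`, so `E[p]` is unramified at every multiplicative
  `ℓ ≠ p`; Serre 1972 Prop. 15 / §5.4).

Hence (this file): `NonSurjCorner.dvd_padicValInt_minimalDiscriminantInt`, `NonSurjCorner.not_ram`
(any prime `p`; `p ≠ 2` is inside `ClassX11b`), and the EQUIVALENCES
`forall_corner_fiveBinders_iff_threeBinders` (each registered stub, at any fixed prime `p₀`, is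
equivalent to its three-binder form `ClassX11b W p → ¬ Surj W p → p = p₀ → MissingPPartAt W p`) and
`nonSurjCorner_iff_threeBinders` / `nonSurjCorner_iff_stubs_threeBinders` (the crux BY NAME is
equivalent to the three-binder statement, and to the conjunction of the two three-binder stubs).
This answers the lineage's open point «binder `p ∣ ord_p Δ_min` idle only on paper» (memo
HOME/corner5/g2/CORNER5-P2-G2.md §1, §5 (P1)) with a kernel citation: a planner re-cut may drop both
binders. HONEST FRAMING: hygiene only — nothing here proves the crux, a stub, or BSD for any class;
no census number moves.

References: [Serre1972] §2.4 Prop. 15, §5.4 Prop. 21; [SilvermanATAEC1994] V.6 Prop. 6.1;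
[SkinnerUrban2014] Thm. 2 (the (ram) hypothesis transcribed as `Ram`).
-/

set_option linter.dupNamespace false -- `Summit.BirchSwinnertonDyer.BirchSwinnertonDyer` (summit = problem), tree-wide
set_option autoImplicit false

noncomputable section

open scoped Classical

open WeierstrassCurve Literature.NumberTheory.EllipticCurves
  Literature.NumberTheory.EllipticCurves.Rank1Residual
  Summit.BirchSwinnertonDyer.Rank1Residual

namespace Summit.BirchSwinnertonDyer.BirchSwinnertonDyer.Theorems.CornerLocal

variable (W : WeierstrassCurve ℚ) [W.IsElliptic] [W.IsGloballyMinimal] (p : ℕ) [hp : Fact p.Prime]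

/-! ### §1. The two idle binders -/

/-- **Binder `p ∣ ord_p Δ_min` is idle on the corner**: for `(E, p)` in class X11b (`r_an = 1`,
`p` odd multiplicative, `E[p]` irreducible) with `ρ̄_{E,p}` NOT onto, `p` divides the exponent of `p`
in the minimal discriminant (equivalently `p ∣ −ord_p j`: the «peu ramifié» case). Contrapositive of
x11c gen 8's `GaloisImage.surj_of_mult_of_irr_of_not_dvd` (très ramifié ⇒ transvection in the inertia
at `p` ⇒ `p ∣ #ρ̄(Γ_ℚ)` ⇒ with irreducibility `ρ̄ ⊇ SL₂(𝔽_p)` ⇒ onto).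
[cite: SilvermanATAEC1994, V.6 Prop. 6.1] [cite: Serre1972, §2.4 Prop. 15] -/
theorem NonSurjCorner.dvd_padicValInt_minimalDiscriminantInt (hX : ClassX11b W p) (hns : ¬ Surj W p) :
    p ∣ padicValInt p W.minimalDiscriminantInt := by
  by_contra h
  exact hns (GaloisImage.surj_of_mult_of_irr_of_not_dvd W p hX.2.1 hX.2.2.1 hX.2.2.2 h)

/-- **Binder `¬ Ram` is idle on the corner**: for `(E, p)` in class X11b with `ρ̄_{E,p}` NOT onto there
is no (ram) witness — `E[p]` is unramified at every multiplicative `ℓ ≠ p` (`p ∣ ord_ℓ Δ_min`), by the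
tree's `Rank1Residual.not_ram_of_irr_of_not_surj`. (The lineage's `CornerShape.NonSurjCorner.
not_ram_not_semistable_seven` had this at `p = 7` together with non-semistability.)
[cite: Serre1972, §2.4 Prop. 15 and §5.4 Prop. 21 (ii)] [cite: SkinnerUrban2014, Thm. 2 (hypothesis (ram))] -/
theorem NonSurjCorner.not_ram (hX : ClassX11b W p) (hns : ¬ Surj W p) : ¬ Ram W p :=
  not_ram_of_irr_of_not_surj W p hX.2.2.2 hns

/-! ### §2. Five binders ⟺ three binders -/

/-- **Each registered stub is equivalent to its three-binder form.** For any fixed `p₀` (the stubs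
`stub_corner5`, `stub_corner7` of skeleton b2731b9ab55f are the cases `p₀ = 5`, `p₀ = 7`, whose
left-hand side below is their registered signature VERBATIM): the five-binder statement
`ClassX11b → ¬Surj → p = p₀ → p ∣ ord_p Δ_min → ¬Ram → MissingPPartAt` holds for all `(W, p)` iff the
three-binder statement `ClassX11b → ¬Surj → p = p₀ → MissingPPartAt` does (§1 supplies the two dropped
binders). [cite: Serre1972, §2.4 Prop. 15] -/
theorem forall_corner_fiveBinders_iff_threeBinders (p₀ : ℕ) :
    (∀ (W : WeierstrassCurve ℚ) [W.IsElliptic] [W.IsGloballyMinimal] (p : ℕ) [Fact p.Prime],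
        ClassX11b W p → ¬ Surj W p → p = p₀ → p ∣ padicValInt p W.minimalDiscriminantInt →
          ¬ Ram W p → Typed.MissingPPartAt W p) ↔
      (∀ (W : WeierstrassCurve ℚ) [W.IsElliptic] [W.IsGloballyMinimal] (p : ℕ) [Fact p.Prime],
        ClassX11b W p → ¬ Surj W p → p = p₀ → Typed.MissingPPartAt W p) := by
  refine ⟨fun h W _ _ p _ hX hns hp ↦ ?_, fun h W _ _ p _ hX hns hp _ _ ↦ h W p hX hns hp⟩
  exact h W p hX hns hp (NonSurjCorner.dvd_padicValInt_minimalDiscriminantInt W p hX hns)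
    (NonSurjCorner.not_ram W p hX hns)

/-- **The crux BY NAME is equivalent to its three-binder form**:
`Theses.ErratumRoadFive.NonSurjCorner ↔ ∀ (E, p), ClassX11b → ¬Surj → (p = 5 ∨ p = 7) → MissingPPartAt`.
The binders `p ∣ ord_p Δ_min` and `¬ Ram` of the crux are consequences of `ClassX11b ∧ ¬Surj` (§1), so a
planner re-cut may drop them without changing the content. Nothing about BSD is claimed.
[cite: Serre1972, §2.4 Prop. 15] -/
theorem nonSurjCorner_iff_threeBinders :
    Theses.ErratumRoadFive.NonSurjCorner ↔
      ∀ (W : WeierstrassCurve ℚ) [W.IsElliptic] [W.IsGloballyMinimal] (p : ℕ) [Fact p.Prime],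
        ClassX11b W p → ¬ Surj W p → (p = 5 ∨ p = 7) → Typed.MissingPPartAt W p := by
  refine ⟨fun h W _ _ p _ hX hns hp ↦ ?_, fun h W _ _ p _ hX hns hp _ _ ↦ h W p hX hns hp⟩
  exact h W p hX hns hp (NonSurjCorner.dvd_padicValInt_minimalDiscriminantInt W p hX hns)
    (NonSurjCorner.not_ram W p hX hns)

/-- **The crux BY NAME is the conjunction of the two three-binder stubs** (`p = 5` branch = the 64
census class-pairs `5S4` 52 + `5Ns` 12 below `5·10⁵`; `p = 7` branch = the `N_s(7)` members, none below
`5·10⁵`): `NonSurjCorner ↔ (three-binder stub at 5) ∧ (three-binder stub at 7)`.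
[cite: Serre1972, §2.4 Prop. 15] [cite: Zywina2015, Thm. 1.4 (ℓ = 5) and Thm. 1.5 (ℓ = 7)] -/
theorem nonSurjCorner_iff_stubs_threeBinders :
    Theses.ErratumRoadFive.NonSurjCorner ↔
      (∀ (W : WeierstrassCurve ℚ) [W.IsElliptic] [W.IsGloballyMinimal] (p : ℕ) [Fact p.Prime],
          ClassX11b W p → ¬ Surj W p → p = 5 → Typed.MissingPPartAt W p) ∧
        (∀ (W : WeierstrassCurve ℚ) [W.IsElliptic] [W.IsGloballyMinimal] (p : ℕ) [Fact p.Prime],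
          ClassX11b W p → ¬ Surj W p → p = 7 → Typed.MissingPPartAt W p) := by
  rw [nonSurjCorner_iff_threeBinders]
  refine ⟨fun h ↦ ⟨fun W _ _ p _ hX hns hp ↦ h W p hX hns (Or.inl hp),
    fun W _ _ p _ hX hns hp ↦ h W p hX hns (Or.inr hp)⟩, fun h W _ _ p _ hX hns hp ↦ ?_⟩
  rcases hp with hp | hp
  · exact h.1 W p hX hns hp
  · exact h.2 W p hX hns hp

end Summit.BirchSwinnertonDyer.BirchSwinnertonDyer.Theorems.CornerLocal

end
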